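import Mathlib

/-!
# Augmentation ideal of a triangular extension `X ↦ X + g` (card G, lever (T))

(crux stmt-ResolutionOfSingularities-15640 `WildQuotients.WildQuotientResolution`; research rung R-T /
R1a of `L/w45c/CHAIN.md` v6, res-L1-w45c-idea-1 round-4 card G «translation-split-base-first», first
checkable step (T); candidate proof by res-L1-w45c-tri-2 (`L/res-L1-w45c-tri-2/TriangularExt.lean`,
sha16 32bf99c363705f74), ported def-free and landed by res-type-035. [OURS · L1 W4.5c] — NOT a
statement of any manuscript (Hironaka 2017 is consumed nowhere); replaces the role of no printed item.
AI-written Lean, kernel-checked; weaker than expert review.)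

For a commutative ring `R`, a ring endomorphism `σ : R →+* R` and ANY `g : R`, the *triangular
extension* of `σ` to `R[X]` is the ring endomorphism `τ := eval₂RingHom (C.comp σ) (X + C g)`, i.e.
`C r ↦ C (σ r)`, `X ↦ X + C g` (equivalently `f ↦ (f.map σ).comp (X + C g)`). Writing
`𝔞(φ) := Ideal.span (range fun s ↦ φ s - s)` for the augmentation ideal of an endomorphism `φ`:

* `augIdeal_triangularExt` — `𝔞(τ) = 𝔞(σ)·R[X] ⊔ (C g)`;
* `augIdeal_triangularExt_eq_map` — the normal form `𝔞(τ) = (𝔞(σ) ⊔ (g))·R[X]`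
  (so `R[X] ⧸ 𝔞(τ) ≅ (R ⧸ (𝔞(σ) + (g)))[X]` by `Ideal.polynomialQuotientEquivQuotientPolynomial`:
  the fixed locus of the extended action is `Z(ḡ) × 𝔸¹` over the fixed locus of the base action);
* `augIdeal_triangularExt_add_coboundary` / `augIdeal_triangularExt_coboundary` — only the class of
  `g` modulo coboundaries `σ h - h` matters (card G: `g ~ g − δh`, `w ~ w − h`); a coboundary
  translation gives the ideal extended from the base;
* `augIdeal_mapRingHom` — the case `g = 0` (coefficientwise action `f ↦ f.map σ`).

No hypothesis on `σ` or `g` (no `Tr g = 0`, no bijectivity, no finiteness of order, no regularity).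
All statements are def-free (the two displayed ideals are spelled out), so consumers rewrite directly.
-/

-- single-problem summit: the doubled namespace component `ResolutionOfSingularities` is forced
set_option linter.dupNamespace false

open Polynomial

namespace Summit.ResolutionOfSingularities.ResolutionOfSingularities.Theorems.WildQuotientResolution.TriangularExt

variable {R : Type*} [CommRing R]

/-- The triangular extension sends a constant `C r` to `C (σ r)`. [folklore] -/
theorem triangularExt_C (σ : R →+* R) (g r : R) :
    eval₂RingHom (C.comp σ) (X + C g) (C r) = C (σ r) := by
  simp

/-- The triangular extension sends `X` to `X + C g`. [folklore] -/
theorem triangularExt_X (σ : R →+* R) (g : R) :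
    eval₂RingHom (C.comp σ) (X + C g) X = X + C g := by
  simp

/-- The triangular extension is `f ↦ (f.map σ).comp (X + C g)`: apply `σ` to the coefficients, then
translate the variable by `g`. [folklore] -/
theorem triangularExt_apply_eq_comp_map (σ : R →+* R) (g : R) (f : R[X]) :
    eval₂RingHom (C.comp σ) (X + C g) f = (f.map σ).comp (X + C g) := by
  rw [coe_eval₂RingHom, comp, eval₂_map]

/-- `φ s - s` lies in the augmentation ideal `⟨φ s - s : s⟩` of `φ`. [folklore] -/
theorem sub_mem_span_range_sub {S : Type*} [CommRing S] (φ : S →+* S) (s : S) :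
    φ s - s ∈ Ideal.span (Set.range fun t : S => φ t - t) :=
  Ideal.subset_span ⟨s, rfl⟩

/-- Twisted Leibniz rule: `φ (f h) - f h = (φ f - f) · φ h + f · (φ h - h)`. [folklore] -/
theorem map_mul_sub_mul {S : Type*} [CommRing S] (φ : S →+* S) (f h : S) :
    φ (f * h) - f * h = (φ f - f) * φ h + f * (φ h - h) := by
  rw [map_mul]; ring

/-- **Lever (T) of card G** (res-L1-w45c-idea-1 round 4; proof after res-L1-w45c-tri-2): for ANY
commutative ring `R`, ANY ring endomorphism `σ` of `R` and ANY `g : R`, the augmentation ideal of the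
triangular extension `τ = eval₂RingHom (C.comp σ) (X + C g)` (`C r ↦ C (σ r)`, `X ↦ X + C g`) of
`σ` to `R[X]` is the extension of the augmentation ideal of `σ` plus the principal ideal `(C g)`:
`⟨τ f - f : f⟩ = ⟨σ s - s : s⟩·R[X] ⊔ (C g)`.
`⊆`: on a monomial, `τ (C r Xⁿ) - C r Xⁿ = C (σ r - r)(X + C g)ⁿ + C r ((X + C g)ⁿ - Xⁿ)` and
`C g = (X + C g) - X` divides the last bracket; `⊇`: `C (σ r - r) = τ (C r) - C r`, `C g = τ X - X`.
[OURS · W4.5c] -/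
theorem augIdeal_triangularExt (σ : R →+* R) (g : R) :
    Ideal.span (Set.range fun f : R[X] => eval₂RingHom (C.comp σ) (X + C g) f - f)
      = (Ideal.span (Set.range fun s : R => σ s - s)).map C ⊔ Ideal.span {C g} := by
  classical
  set τ : R[X] →+* R[X] := eval₂RingHom (C.comp σ) (X + C g) with hτ
  set I : Ideal R[X] := (Ideal.span (Set.range fun s : R => σ s - s)).map C ⊔ Ideal.span {C g}
    with hI
  apply le_antisymm
  · -- every `τ f - f` lies in `I`
    refine Ideal.span_le.mpr ?_
    rintro _ ⟨f, rfl⟩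
    show τ f - f ∈ I
    induction f using Polynomial.induction_on' with
    | add p q hp hq =>
        have h : τ (p + q) - (p + q) = (τ p - p) + (τ q - q) := by rw [map_add]; ring
        rw [h]
        exact I.add_mem hp hq
    | monomial n r =>
        rw [← C_mul_X_pow_eq_monomial]
        have h1 : τ (C r * X ^ n) - C r * X ^ n
            = (C (σ r) - C r) * (X + C g) ^ n + C r * ((X + C g) ^ n - X ^ n) := by
          rw [map_mul, map_pow, hτ, triangularExt_C, triangularExt_X]; ring
        rw [h1]
        refine I.add_mem ?_ ?_
        · refine Ideal.mul_mem_right _ _ (Ideal.mem_sup_left ?_)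
          have h2 : C (σ r) - C r = C (σ r - r) := by simp
          rw [h2]
          exact Ideal.mem_map_of_mem _ (sub_mem_span_range_sub σ r)
        · refine Ideal.mul_mem_left _ _ (Ideal.mem_sup_right (Ideal.mem_span_singleton.mpr ?_))
          have h3 := sub_dvd_pow_sub_pow (X + C g) (X : R[X]) n
          rwa [add_sub_cancel_left] at h3
  · -- `I ≤ ⟨τ f - f⟩`
    refine sup_le ?_ ?_
    · refine Ideal.map_le_iff_le_comap.mpr (Ideal.span_le.mpr ?_)
      rintro _ ⟨r, rfl⟩
      show C (σ r - r) ∈ Ideal.span (Set.range fun f : R[X] => τ f - f)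
      have h : C (σ r - r) = τ (C r) - C r := by rw [hτ, triangularExt_C, map_sub]
      rw [h]
      exact sub_mem_span_range_sub τ (C r)
    · refine Ideal.span_le.mpr ?_
      rintro _ ⟨rfl⟩
      show C g ∈ Ideal.span (Set.range fun f : R[X] => τ f - f)
      have h : C g = τ X - X := by rw [hτ, triangularExt_X]; ring
      rw [h]
      exact sub_mem_span_range_sub τ X

/-- **Normal form of lever (T)**: the augmentation ideal of the triangular extension is extended from
the base, `⟨τ f - f : f⟩ = (⟨σ s - s : s⟩ ⊔ (g))·R[X]`. Hence
`R[X] ⧸ ⟨τ f - f⟩ ≅ (R ⧸ (⟨σ s - s⟩ + (g)))[X]` (`Ideal.polynomialQuotientEquivQuotientPolynomial`):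
the fixed scheme of the extended action is `Z(ḡ) × 𝔸¹` over the fixed scheme of `σ`,
`ḡ = g mod ⟨σ s - s⟩` — card G's «every bad component is `Z × 𝔸¹`». [OURS · W4.5c] -/
theorem augIdeal_triangularExt_eq_map (σ : R →+* R) (g : R) :
    Ideal.span (Set.range fun f : R[X] => eval₂RingHom (C.comp σ) (X + C g) f - f)
      = (Ideal.span (Set.range fun s : R => σ s - s) ⊔ Ideal.span {g}).map C := by
  rw [augIdeal_triangularExt, Ideal.map_sup, Ideal.map_span C {g}, Set.image_singleton]

/-- Pointwise form of lever (T), direction `⊆`: every `τ f - f` lies in `⟨σ s - s : s⟩·R[X] ⊔ (C g)`.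
[OURS · W4.5c] -/
theorem triangularExt_sub_mem (σ : R →+* R) (g : R) (f : R[X]) :
    eval₂RingHom (C.comp σ) (X + C g) f - f
      ∈ (Ideal.span (Set.range fun s : R => σ s - s)).map C ⊔ Ideal.span {C g} := by
  rw [← augIdeal_triangularExt]
  exact sub_mem_span_range_sub _ f

/-- The case `g = 0` (pure coefficient action, no translation): the augmentation ideal of
`f ↦ f.map σ` on `R[X]` is extended from `R`, `⟨f.map σ - f⟩ = ⟨σ s - s⟩·R[X]`. [OURS · W4.5c] -/
theorem augIdeal_mapRingHom (σ : R →+* R) :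
    Ideal.span (Set.range fun f : R[X] => f.map σ - f)
      = (Ideal.span (Set.range fun s : R => σ s - s)).map C := by
  have h := augIdeal_triangularExt_eq_map σ 0
  have h0 : ∀ f : R[X], eval₂RingHom (C.comp σ) (X + C (0 : R)) f = f.map σ := by
    intro f
    rw [triangularExt_apply_eq_comp_map, map_zero, add_zero, comp_X]
  simp only [h0] at h
  rw [h, Ideal.span_singleton_eq_bot.mpr rfl, sup_bot_eq]

/-- `I ⊔ (g + i) = I ⊔ (g)` for `i ∈ I`: a principal summand may be moved by any element of the other
summand. [folklore] -/
theorem sup_span_singleton_add_eq_of_mem {S : Type*} [CommRing S] (I : Ideal S) {i : S} (hi : i ∈ I)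
    (g : S) : I ⊔ Ideal.span {g + i} = I ⊔ Ideal.span {g} := by
  apply le_antisymm
  · refine sup_le le_sup_left ((Ideal.span_singleton_le_iff_mem _).mpr ?_)
    exact Ideal.add_mem _ (Ideal.mem_sup_right (Ideal.mem_span_singleton_self g))
      (Ideal.mem_sup_left hi)
  · refine sup_le le_sup_left ((Ideal.span_singleton_le_iff_mem _).mpr ?_)
    have h := Ideal.sub_mem (I ⊔ Ideal.span {g + i})
      (Ideal.mem_sup_right (Ideal.mem_span_singleton_self (g + i))) (Ideal.mem_sup_left hi)
    rwa [add_sub_cancel_right] at h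

/-- **Coboundary invariance of lever (T)** (card G: «only the class of `g` modulo coboundaries
matters, `g ~ g − δh`, `w ~ w − h`»): replacing `g` by `g + (σ h - h)` does not change the
augmentation ideal of the triangular extension (indeed `X ↦ X + C h` conjugates the two extensions).
[OURS · W4.5c] -/
theorem augIdeal_triangularExt_add_coboundary (σ : R →+* R) (g h : R) :
    Ideal.span (Set.range fun f : R[X] => eval₂RingHom (C.comp σ) (X + C (g + (σ h - h))) f - f)
      = Ideal.span (Set.range fun f : R[X] => eval₂RingHom (C.comp σ) (X + C g) f - f) := by
  rw [augIdeal_triangularExt_eq_map, augIdeal_triangularExt_eq_map,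
    sup_span_singleton_add_eq_of_mem _ (sub_mem_span_range_sub σ h)]

/-- In particular a COBOUNDARY translation `g = σ h - h` contributes nothing: the augmentation ideal of
the triangular extension by `σ h - h` is extended from the base, `= ⟨σ s - s⟩·R[X]` (the variable
`X - C h` is invariant). [OURS · W4.5c] -/
theorem augIdeal_triangularExt_coboundary (σ : R →+* R) (h : R) :
    Ideal.span (Set.range fun f : R[X] => eval₂RingHom (C.comp σ) (X + C (σ h - h)) f - f)
      = (Ideal.span (Set.range fun s : R => σ s - s)).map C := by
  have e := augIdeal_triangularExt_add_coboundary σ 0 h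
  rw [zero_add] at e
  rw [e, augIdeal_triangularExt_eq_map, Ideal.span_singleton_eq_bot.mpr rfl, sup_bot_eq]

/-!
## Fixed locus of the triangular extension (appended by res-type-035 g8, card G step (T) corollary)

The normal form `augIdeal_triangularExt_eq_map` says that `𝔞(τ)` is extended from the base ideal
`𝔞(σ) ⊔ (g)`; below it is recast as (i) the kernel of the coefficientwise reduction
`R[X] → (R ⧸ (𝔞(σ) ⊔ (g)))[X]`, (ii) an explicit ring isomorphism
`(R ⧸ (𝔞(σ) ⊔ (g)))[X] ≃+* R[X] ⧸ 𝔞(τ)` (existence, def-free), (iii) the contraction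
`𝔞(τ) ∩ R = 𝔞(σ) ⊔ (g)`; plus (iv) the transport of augmentation ideals along a ring isomorphism
(for users working in `MvPolynomial (Fin (n+1)) k ≃ (MvPolynomial (Fin n) k)[X]`). This is card G's
sentence «`Fix(X′) = Z(ḡ) × 𝔸¹` with `ḡ := g mod 𝔞(σ_B)`; every bad component is `Z × 𝔸¹`».
The companion sentence «`Bl_{Z×𝔸¹} X′ = Bl_Z B × 𝔸¹`» is flat base change of blow-ups along
`R → R[X]` and is ALREADY in the tree (`Literature.AlgebraicGeometry.Resolution.IsBlowup.pullback_snd_of_flat`,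
`IsBlowup.isPullback_of_flat`, `IsBlowup.pullback_snd_SpecMap_of_flat`) — cite, do not re-prove.
[OURS · L1 W4.5c] AI-written Lean, kernel-checked; weaker than expert review.
-/

/-- **Fixed locus of lever (T) is `Z(ḡ) × 𝔸¹`, kernel form** (card G (T): «`Fix(X′) = Z(ḡ) × 𝔸¹`
with `ḡ := g mod 𝔞(σ_B)`»): the augmentation ideal `⟨τ f - f⟩` of the triangular extension
`τ = eval₂RingHom (C.comp σ) (X + C g)` is the kernel of the coefficientwise reduction
`mapRingHom (mk (⟨σ s - s⟩ ⊔ (g))) : R[X] → (R ⧸ (⟨σ s - s⟩ ⊔ (g)))[X]`. Geometrically: the fixed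
subscheme `Spec (R[X] ⧸ 𝔞(τ))` of `τ` is the closed subscheme `Spec (R ⧸ (𝔞(σ) + (g))) × 𝔸¹` of
`Spec R[X] = Spec R × 𝔸¹` — the affine line over the zero locus of `ḡ` inside `Fix(σ)`.
Proof: `Polynomial.ker_mapRingHom` + `Ideal.mk_ker` + `augIdeal_triangularExt_eq_map`.
[OURS · W4.5c] -/
theorem ker_mapRingHom_mk_eq_augIdeal_triangularExt (σ : R →+* R) (g : R) :
    RingHom.ker (mapRingHom (Ideal.Quotient.mk
        (Ideal.span (Set.range fun s : R => σ s - s) ⊔ Ideal.span {g})))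
      = Ideal.span (Set.range fun f : R[X] => eval₂RingHom (C.comp σ) (X + C g) f - f) := by
  rw [Polynomial.ker_mapRingHom, Ideal.mk_ker, augIdeal_triangularExt_eq_map]

/-- Pointwise membership criterion for `𝔞(τ)`: a polynomial lies in the augmentation ideal of the
triangular extension iff all its coefficients vanish in `R ⧸ (⟨σ s - s⟩ ⊔ (g))`, i.e. iff its
coefficientwise reduction is `0`. [OURS · W4.5c] -/
theorem map_mk_eq_zero_iff_mem_augIdeal_triangularExt (σ : R →+* R) (g : R) (f : R[X]) :
    f.map (Ideal.Quotient.mk (Ideal.span (Set.range fun s : R => σ s - s) ⊔ Ideal.span {g})) = 0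
      ↔ f ∈ Ideal.span (Set.range fun f : R[X] => eval₂RingHom (C.comp σ) (X + C g) f - f) := by
  rw [← ker_mapRingHom_mk_eq_augIdeal_triangularExt, RingHom.mem_ker, coe_mapRingHom]

/-- **`Fix(τ) ≅ Z(ḡ) × 𝔸¹` as rings** (existence form, def-free): there is a ring isomorphism
`(R ⧸ (⟨σ s - s⟩ ⊔ (g)))[X] ≃+* R[X] ⧸ ⟨τ f - f⟩`, namely
`Ideal.polynomialQuotientEquivQuotientPolynomial` followed by `Ideal.quotEquivOfEq` along
`augIdeal_triangularExt_eq_map` (so it sends `C r̄ ↦ [C r]` and `X ↦ [X]`; consumers needing the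
map itself should write that composite — it is two Mathlib constructors, no new definition here).
[OURS · W4.5c] -/
theorem nonempty_ringEquiv_quotient_augIdeal_triangularExt (σ : R →+* R) (g : R) :
    Nonempty ((R ⧸ (Ideal.span (Set.range fun s : R => σ s - s) ⊔ Ideal.span {g}))[X] ≃+*
      R[X] ⧸ Ideal.span (Set.range fun f : R[X] => eval₂RingHom (C.comp σ) (X + C g) f - f)) :=
  ⟨(Ideal.polynomialQuotientEquivQuotientPolynomial _).trans
    (Ideal.quotEquivOfEq (augIdeal_triangularExt_eq_map σ g).symm)⟩

/-- **Contraction to the base**: `𝔞(τ) ∩ R = 𝔞(σ) ⊔ (g)` — the augmentation ideal of the triangular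
extension contracts along `C : R → R[X]` to the base ideal `⟨σ s - s⟩ ⊔ (g)` (the zero section
`X = 0` meets `Fix(τ) = Z(ḡ) × 𝔸¹` in `Z(ḡ)`). In particular `g ∈ 𝔞(τ) ∩ R` although `g` need not
lie in `𝔞(σ)`: the translation digit is visible on the base only through this contraction.
[OURS · W4.5c] -/
theorem comap_C_augIdeal_triangularExt (σ : R →+* R) (g : R) :
    (Ideal.span (Set.range fun f : R[X] => eval₂RingHom (C.comp σ) (X + C g) f - f)).comap C
      = Ideal.span (Set.range fun s : R => σ s - s) ⊔ Ideal.span {g} := by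
  rw [augIdeal_triangularExt_eq_map]
  ext r
  rw [Ideal.mem_comap, Ideal.mem_map_C_iff]
  constructor
  · intro h
    simpa using h 0
  · intro h n
    rw [coeff_C]
    split_ifs
    · exact h
    · exact Ideal.zero_mem _

/-- **Transport of augmentation ideals along a ring isomorphism**: for `e : A ≃+* B` and an
endomorphism `φ` of `A`, the augmentation ideal of the conjugate `e ∘ φ ∘ e⁻¹` is the image of the
augmentation ideal of `φ` under `e`. (Use: move lever (T) between `R[X]` with `R = MvPolynomial
(Fin n) k` and `MvPolynomial (Fin (n+1)) k` through `MvPolynomial.finSuccEquiv`, or between any two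
presentations of the same coordinate ring; no hypothesis on `φ`.) [folklore] -/
theorem augIdeal_conj_ringEquiv {A B : Type*} [CommRing A] [CommRing B] (e : A ≃+* B)
    (φ : A →+* A) :
    Ideal.span (Set.range fun b : B =>
        (e.toRingHom.comp (φ.comp e.symm.toRingHom)) b - b)
      = (Ideal.span (Set.range fun a : A => φ a - a)).map e.toRingHom := by
  rw [Ideal.map_span]
  congr 1
  ext x
  constructor
  · rintro ⟨b, rfl⟩
    refine ⟨φ (e.symm b) - e.symm b, ⟨e.symm b, rfl⟩, ?_⟩
    simp
  · rintro ⟨_, ⟨a, rfl⟩, rfl⟩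
    refine ⟨e a, ?_⟩
    simp

end Summit.ResolutionOfSingularities.ResolutionOfSingularities.Theorems.WildQuotientResolution.TriangularExt
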